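import Summits.CriticalPhenomena.PercolationContinuityZ3.Theorems.PercNearOneGluingNoHeavyLowerTailSunflowerMultiPetalModule
import Summits.CriticalPhenomena.PercolationContinuityZ3.Theorems.PercNearOneGluingNoHeavyLowerTailSunflowerMultiPetalSpectator
import HarnessLib
import HarnessLib.Audit

/-!
# `NoHeavyLowerTail` (crux stmt-CriticalPhenomena-4575), abstract sunflower cubic, `k` petals: THEOREM C for three gadgets —
# ★ₖ for a 3-gadget blow-up from the 64 grouped coefficients of its quotient, and ★ₖ for EVERY blow-up of the CO-STAR structure

Support file (seat `prim-l12-p2` gen 30; `--supports stmt-CriticalPhenomena-4575`; companion of `…SunflowerMultiPetalModule` (p358966/p359376: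
`IsModule`, `gsum`, `glue`, `patCount`, `gsum_eq_sum_pattern`, `ZK_eq_sum_three_modules`) and `…SunflowerMultiPetalSpectator` (`s6K_congr`)).  Everything here
is PROVED; no `sorry`, no named facts; the one finite check (`coef3Costar_nonneg`, 64 sums of kernel values on `Fin 5`) is a kernel `decide`.
Memo: run/shared/lean/prim/prim-l12/prim-l12-p2/FINDING-g30-HOME-ROUTING.md §5 (Conjecture G, Theorem C).

CONTENT.
* Block symmetry of the gadget statistics: `patCount M g P` (the number of traces on the module `M` with firing pattern `P ⊆ {0,1,2}`) depends only on
  `#P` (`patCount_swap01`, `patCount_swap02` from prim-ineq-gen-2's block symmetries of `partsOf`-sums; `patCount_eq_canon` via two `decide`d facts about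
  the eight patterns).
* `ZK_eq_sum_coef3`: for a ground set covered by three disjoint modules, `ZK = Σ_{j ∈ {0,…,3}³} n₁(j₀)·n₂(j₁)·n₃(j₂)·coef3 j`, where `n_i(j) = patCount M_i g_i
  (canonPat j) ≥ 0` are the gadget statistics and `coef3 j` the 64 GROUPED COEFFICIENTS of the quotient (the sum of the kernel values over all pattern
  triples of size profile `j` — Conjecture G's coefficients `C_λ(s)` for the 3-point quotient `λ`).  Hence **`ZK_nonneg_of_coef3_nonneg`** — Theorem C of the
  memo for three gadgets: ★ₖ for the blow-up follows from the 64 signs of its quotient, whatever the gadgets and their sizes.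
* The CO-STAR quotient (`IsCoStarQuotient`: the union of the three modules is top, every single module and `∅` are bottom, the three pairs carry three
  pairwise distinct petal labels): its labels are transported to a model on `Fin 5` (`chart_tb`, `chart_eq`, `coef3_eq` via `s6K_congr`), the model's 64
  coefficients are `decide`d nonnegative (`coef3Costar_nonneg`; in the gadget statistics `ZK = 6(a₁b₁c₁ + a₁b₁c₂ + a₁b₂c₁ + a₂b₁c₁)`), whence
  **`ZK_nonneg_of_isCoStarQuotient`: ★ₖ (`0 ≤ ZK`) for EVERY blow-up of the co-star structure by three arbitrary monotone gadgets** — all co-stars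
  `co-star(a,b,c)` with or without dummies, the doubled star `co-star(2,2,2)` (the 6-point structure that killed (LM), Lemma B and the white-only rainbow
  routing), mixed OR/AND/majority legs, for all sizes at once.
-/

namespace Summit.CriticalPhenomena.PercolationContinuityZ3.Theorems.SunflowerPartition

open Finset

variable {α : Type*} [DecidableEq α]

namespace MSunflower

variable {k : ℕ} (F : MSunflower k α)

/-! ## Block symmetry: the gadget statistics `patCount M g P` depend only on `#P` -/

/-- The firing pattern as a function of the three Boolean gadget values. [this work] -/
def patB (a b c : Bool) : Finset (Fin 3) :=
  (univ : Finset (Fin 3)).filter fun j => (j = 0 ∧ a = true) ∨ (j = 1 ∧ b = true) ∨ (j = 2 ∧ c = true)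

omit [DecidableEq α] in
/-- `pat` in terms of `patB`. [this work] -/
theorem pat_eq_patB [DecidableEq α] (M : Finset α) (g : Finset α → Bool) (s : Finset α × Finset α) :
    pat M g s = patB (g s.1) (g s.2) (g (M \ (s.1 ∪ s.2))) := rfl

/-- Transposition of the block indices `0, 1` on a pattern. [this work] -/
def swap01 (P : Finset (Fin 3)) : Finset (Fin 3) := P.image (Equiv.swap (0 : Fin 3) 1)

/-- Transposition of the block indices `0, 2` on a pattern. [this work] -/
def swap02 (P : Finset (Fin 3)) : Finset (Fin 3) := P.image (Equiv.swap (0 : Fin 3) 2)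

/-- `swap01` is an involution. [this work] -/
theorem swap01_swap01 : ∀ P : Finset (Fin 3), swap01 (swap01 P) = P := by decide

/-- `swap02` is an involution. [this work] -/
theorem swap02_swap02 : ∀ P : Finset (Fin 3), swap02 (swap02 P) = P := by decide

/-- Exchanging the first two gadget values transposes `0, 1` in the pattern. [this work] -/
theorem patB_swap12 : ∀ a b c : Bool, patB b a c = swap01 (patB a b c) := by decide

/-- Exchanging the first and third gadget values transposes `0, 2` in the pattern. [this work] -/
theorem patB_swap13 : ∀ a b c : Bool, patB c b a = swap02 (patB a b c) := by decide

/-- `patCount` as a sum of indicators over `partsOf M`. [this work] -/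
theorem patCount_eq_sum (M : Finset α) (g : Finset α → Bool) (P : Finset (Fin 3)) :
    patCount M g P = ∑ s ∈ partsOf M, (if patB (g s.1) (g s.2) (g (M \ (s.1 ∪ s.2))) = P then (1 : ℤ) else 0) := by
  unfold patCount
  rw [Finset.sum_boole]
  rfl

/-- Block symmetry `0 ↔ 1` of the gadget statistics. [this work] -/
theorem patCount_swap01 (M : Finset α) (g : Finset α → Bool) (P : Finset (Fin 3)) :
    patCount M g (swap01 P) = patCount M g P := by
  rw [patCount_eq_sum, patCount_eq_sum,
    sum_partsOf_swap12 M (fun X Y Z => if patB (g X) (g Y) (g Z) = P then (1 : ℤ) else 0)]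
  refine sum_congr rfl fun s _ => ?_
  simp only [patB_swap12 (g s.1) (g s.2)]
  set A := patB (g s.1) (g s.2) (g (M \ (s.1 ∪ s.2)))
  have key : A = swap01 P ↔ swap01 A = P :=
    ⟨fun h => by rw [h, swap01_swap01], fun h => by rw [← h, swap01_swap01]⟩
  by_cases hA : A = swap01 P
  · rw [if_pos hA, if_pos (key.1 hA)]
  · rw [if_neg hA, if_neg (fun h' => hA (key.2 h'))]

/-- Block symmetry `0 ↔ 2` of the gadget statistics. [this work] -/
theorem patCount_swap02 (M : Finset α) (g : Finset α → Bool) (P : Finset (Fin 3)) :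
    patCount M g (swap02 P) = patCount M g P := by
  rw [patCount_eq_sum, patCount_eq_sum,
    sum_partsOf_swap13 M (fun X Y Z => if patB (g X) (g Y) (g Z) = P then (1 : ℤ) else 0)]
  refine sum_congr rfl fun s _ => ?_
  simp only [patB_swap13 (g s.1) (g s.2)]
  set A := patB (g s.1) (g s.2) (g (M \ (s.1 ∪ s.2)))
  have key : A = swap02 P ↔ swap02 A = P :=
    ⟨fun h => by rw [h, swap02_swap02], fun h => by rw [← h, swap02_swap02]⟩
  by_cases hA : A = swap02 P
  · rw [if_pos hA, if_pos (key.1 hA)]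
  · rw [if_neg hA, if_neg (fun h' => hA (key.2 h'))]

/-- The canonical pattern of each size. [this work] -/
def canonPat (j : ℕ) : Finset (Fin 3) :=
  if j = 0 then ∅ else if j = 1 then {0} else if j = 2 then {0, 1} else univ

/-- Every pattern is carried to the canonical pattern of its size by at most two of the transpositions. [this work] -/
theorem canonPat_cases : ∀ P : Finset (Fin 3), canonPat P.card = P ∨ canonPat P.card = swap01 P ∨ canonPat P.card = swap02 P ∨
    canonPat P.card = swap01 (swap02 P) ∨ canonPat P.card = swap02 (swap01 P) := by
  decide

/-- **The gadget statistics depend only on the size of the pattern.** [this work] -/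
theorem patCount_eq_canon (M : Finset α) (g : Finset α → Bool) (P : Finset (Fin 3)) :
    patCount M g P = patCount M g (canonPat P.card) := by
  rcases canonPat_cases P with h | h | h | h | h <;> rw [h]
  · rw [patCount_swap01]
  · rw [patCount_swap02]
  · rw [patCount_swap01, patCount_swap02]
  · rw [patCount_swap02, patCount_swap01]

/-! ## Regrouping by size: ★ₖ for a 3-gadget blow-up from the 64 grouped coefficients of its quotient -/

/-- The grouped coefficient of the quotient for the size profile `j = ((j₀, j₁), j₂)`: the sum of the kernel values over all pattern triples with
`#P_i = j_i` (the pattern coefficients `C_λ(s)` of Conjecture G for the 3-point quotient `λ`). [this work] -/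
def coef3 (F : MSunflower k α) (M₁ M₂ M₃ : Finset α) (j : (ℕ × ℕ) × ℕ) : ℤ :=
  ∑ P ∈ (((univ : Finset (Finset (Fin 3))) ×ˢ (univ : Finset (Finset (Fin 3)))) ×ˢ (univ : Finset (Finset (Fin 3)))).filter
      (fun P => ((P.1.1.card, P.1.2.card), P.2.card) = j),
    s6K k (F.lab (glue M₁ P.1.1 0 ∪ glue M₂ P.1.2 0 ∪ glue M₃ P.2 0)) (F.lab (glue M₁ P.1.1 1 ∪ glue M₂ P.1.2 1 ∪ glue M₃ P.2 1))
      (F.lab (glue M₁ P.1.1 2 ∪ glue M₂ P.1.2 2 ∪ glue M₃ P.2 2))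

set_option maxRecDepth 4000 in
/-- **`ZK` of a 3-gadget blow-up, regrouped by the size profile of the patterns**:
`ZK = Σ_{j ∈ (range 4)³} n₁(j₀) n₂(j₁) n₃(j₂) · coef3 j` with `n_i(j) = patCount M_i g_i (canonPat j)` — the trilinear form of Theorem C in the
gadget statistics, with the quotient's pattern coefficients. [this work] -/
theorem ZK_eq_sum_coef3 [Fintype α] {M₁ M₂ M₃ : Finset α} {g₁ g₂ g₃ : Finset α → Bool}
    (h₁ : F.IsModule M₁ g₁) (h₂ : F.IsModule M₂ g₂) (h₃ : F.IsModule M₃ g₃)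
    (d₁₂ : Disjoint M₁ M₂) (d₁₃ : Disjoint M₁ M₃) (d₂₃ : Disjoint M₂ M₃) (hcov : M₁ ∪ M₂ ∪ M₃ = univ) :
    F.ZK = ∑ j ∈ ((range 4) ×ˢ (range 4)) ×ˢ (range 4),
      patCount M₁ g₁ (canonPat j.1.1) * patCount M₂ g₂ (canonPat j.1.2) * patCount M₃ g₃ (canonPat j.2) * F.coef3 M₁ M₂ M₃ j := by
  rw [F.ZK_eq_sum_three_modules h₁ h₂ h₃ d₁₂ d₁₃ d₂₃ hcov]
  -- flatten the nested sums into one sum over triples of patterns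
  simp only [mul_sum]
  rw [← sum_product' (s := (univ : Finset (Finset (Fin 3)))) (t := (univ : Finset (Finset (Fin 3))))
    (f := fun P₁ P₂ => ∑ P₃ : Finset (Fin 3), patCount M₁ g₁ P₁ * (patCount M₂ g₂ P₂ * (patCount M₃ g₃ P₃ *
      s6K k (F.lab (glue M₁ P₁ 0 ∪ glue M₂ P₂ 0 ∪ glue M₃ P₃ 0)) (F.lab (glue M₁ P₁ 1 ∪ glue M₂ P₂ 1 ∪ glue M₃ P₃ 1))
        (F.lab (glue M₁ P₁ 2 ∪ glue M₂ P₂ 2 ∪ glue M₃ P₃ 2)))))]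
  rw [← sum_product' (s := (univ : Finset (Finset (Fin 3))) ×ˢ (univ : Finset (Finset (Fin 3)))) (t := (univ : Finset (Finset (Fin 3))))
    (f := fun Q P₃ => patCount M₁ g₁ Q.1 * (patCount M₂ g₂ Q.2 * (patCount M₃ g₃ P₃ *
      s6K k (F.lab (glue M₁ Q.1 0 ∪ glue M₂ Q.2 0 ∪ glue M₃ P₃ 0)) (F.lab (glue M₁ Q.1 1 ∪ glue M₂ Q.2 1 ∪ glue M₃ P₃ 1))
        (F.lab (glue M₁ Q.1 2 ∪ glue M₂ Q.2 2 ∪ glue M₃ P₃ 2)))))]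
  -- group by the size profile
  rw [← sum_fiberwise_of_maps_to (s := ((univ : Finset (Finset (Fin 3))) ×ˢ (univ : Finset (Finset (Fin 3)))) ×ˢ (univ : Finset (Finset (Fin 3))))
      (t := ((range 4) ×ˢ (range 4)) ×ˢ (range 4))
      (g := fun P : (Finset (Fin 3) × Finset (Fin 3)) × Finset (Fin 3) => ((P.1.1.card, P.1.2.card), P.2.card))]
  · refine sum_congr rfl fun j _ => ?_
    unfold coef3
    rw [mul_sum]
    refine sum_congr rfl fun P hP => ?_
    have hPj : ((P.1.1.card, P.1.2.card), P.2.card) = j := (Finset.mem_filter.mp hP).2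
    rw [patCount_eq_canon M₁ g₁ P.1.1, patCount_eq_canon M₂ g₂ P.1.2, patCount_eq_canon M₃ g₃ P.2, ← hPj]
    ring
  · intro P _
    have c1 : P.1.1.card < 4 := Nat.lt_succ_of_le (le_trans (Finset.card_le_univ _) (by simp))
    have c2 : P.1.2.card < 4 := Nat.lt_succ_of_le (le_trans (Finset.card_le_univ _) (by simp))
    have c3 : P.2.card < 4 := Nat.lt_succ_of_le (le_trans (Finset.card_le_univ _) (by simp))
    simp only [mem_product, mem_range]
    exact ⟨⟨c1, c2⟩, c3⟩

/-- **Corollary (Theorem C for three gadgets, in Lean): ★ₖ for a 3-gadget blow-up from the 64 pattern coefficients of its quotient.**  If the ground set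
of `F` is the disjoint union of three modules and every grouped coefficient `coef3 j` (`j ∈ {0,…,3}³`) is nonnegative, then `0 ≤ F.ZK` — whatever the three
gadgets and their sizes. [this work] -/
theorem ZK_nonneg_of_coef3_nonneg [Fintype α] {M₁ M₂ M₃ : Finset α} {g₁ g₂ g₃ : Finset α → Bool}
    (h₁ : F.IsModule M₁ g₁) (h₂ : F.IsModule M₂ g₂) (h₃ : F.IsModule M₃ g₃)
    (d₁₂ : Disjoint M₁ M₂) (d₁₃ : Disjoint M₁ M₃) (d₂₃ : Disjoint M₂ M₃) (hcov : M₁ ∪ M₂ ∪ M₃ = univ)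
    (hC : ∀ j ∈ ((range 4) ×ˢ (range 4)) ×ˢ (range 4), 0 ≤ F.coef3 M₁ M₂ M₃ j) : 0 ≤ F.ZK := by
  rw [F.ZK_eq_sum_coef3 h₁ h₂ h₃ d₁₂ d₁₃ d₂₃ hcov]
  exact sum_nonneg fun j hj => mul_nonneg (mul_nonneg (mul_nonneg (patCount_nonneg _ _ _) (patCount_nonneg _ _ _))
    (patCount_nonneg _ _ _)) (hC j hj)


/-! ## The CO-STAR rule: ★ₖ for every blow-up of the 3-point co-star structure by three arbitrary gadgets -/

section CoStar

/-- The union of the modules selected by three Booleans. [this work] -/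
def modUnion (M₁ M₂ M₃ : Finset α) (b : Bool × Bool × Bool) : Finset α :=
  (if b.1 = true then M₁ else ∅) ∪ (if b.2.1 = true then M₂ else ∅) ∪ (if b.2.2 = true then M₃ else ∅)

/-- The glued block `i` of a pattern triple is the union of the modules selected by the memberships of `i`. [this work] -/
theorem glue_union_eq_modUnion (M₁ M₂ M₃ : Finset α) (P₁ P₂ P₃ : Finset (Fin 3)) (i : Fin 3) :
    glue M₁ P₁ i ∪ glue M₂ P₂ i ∪ glue M₃ P₃ i = modUnion M₁ M₂ M₃ (decide (i ∈ P₁), decide (i ∈ P₂), decide (i ∈ P₃)) := by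
  unfold glue modUnion
  simp only [decide_eq_true_eq]

/-- The model labelling of the co-star quotient on `Fin 5`: top (`4`) iff all three modules, bottom (`0`) iff at most one, and three distinct petal
labels `1, 2, 3` for the three pairs. [this work] -/
def mlCostar : Bool × Bool × Bool → Fin 5
  | (true, true, true) => 4
  | (true, true, false) => 1
  | (true, false, true) => 2
  | (false, true, true) => 3
  | _ => 0

/-- The CO-STAR hypotheses on the quotient of `F` by three modules: all three modules together are top, at most one module is bottom, and the three
pairs carry three pairwise distinct petal labels. [this work] -/
structure IsCoStarQuotient (F : MSunflower k α) (M₁ M₂ M₃ : Finset α) : Prop where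
  top_all : F.lab (M₁ ∪ M₂ ∪ M₃) = Fin.last (k + 1)
  bot_empty : F.lab ∅ = 0
  bot₁ : F.lab M₁ = 0
  bot₂ : F.lab M₂ = 0
  bot₃ : F.lab M₃ = 0
  p₁₂_top : F.lab (M₁ ∪ M₂) ≠ Fin.last (k + 1)
  p₁₂_bot : F.lab (M₁ ∪ M₂) ≠ 0
  p₁₃_top : F.lab (M₁ ∪ M₃) ≠ Fin.last (k + 1)
  p₁₃_bot : F.lab (M₁ ∪ M₃) ≠ 0
  p₂₃_top : F.lab (M₂ ∪ M₃) ≠ Fin.last (k + 1)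
  p₂₃_bot : F.lab (M₂ ∪ M₃) ≠ 0
  ne₁₂_₁₃ : F.lab (M₁ ∪ M₂) ≠ F.lab (M₁ ∪ M₃)
  ne₁₂_₂₃ : F.lab (M₁ ∪ M₂) ≠ F.lab (M₂ ∪ M₃)
  ne₁₃_₂₃ : F.lab (M₁ ∪ M₃) ≠ F.lab (M₂ ∪ M₃)

variable {F} {M₁ M₂ M₃ : Finset α}

/-- Under the co-star hypotheses the label of every union of modules is top / bottom exactly when the model label is. [this work] -/
theorem IsCoStarQuotient.chart_tb (h : F.IsCoStarQuotient M₁ M₂ M₃) (b : Bool × Bool × Bool) :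
    (F.lab (modUnion M₁ M₂ M₃ b) = Fin.last (k + 1) ↔ mlCostar b = 4) ∧ (F.lab (modUnion M₁ M₂ M₃ b) = 0 ↔ mlCostar b = 0) := by
  obtain ⟨hT, h0, h1, h2, h3, a1, a2, a3, a4, a5, a6, n1, n2, n3⟩ := h
  have l0 : (Fin.last (k + 1) : Fin (k + 2)) ≠ 0 := by
    intro h; have := congrArg Fin.val h; simp at this
  rcases b with ⟨_ | _, _ | _, _ | _⟩ <;>
    simp only [modUnion, if_true, Bool.false_eq_true, if_false, empty_union, union_empty, mlCostar] <;>
    refine ⟨⟨fun h => ?_, fun h => ?_⟩, ⟨fun h => ?_, fun h => ?_⟩⟩ <;>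
    first
    | decide
    | exact absurd h (by decide)
    | simp_all

/-- Under the co-star hypotheses two unions of modules have equal labels exactly when their model labels agree. [this work] -/
theorem IsCoStarQuotient.chart_eq (h : F.IsCoStarQuotient M₁ M₂ M₃) (b b' : Bool × Bool × Bool) :
    F.lab (modUnion M₁ M₂ M₃ b) = F.lab (modUnion M₁ M₂ M₃ b') ↔ mlCostar b = mlCostar b' := by
  obtain ⟨hT, h0, h1, h2, h3, a1, a2, a3, a4, a5, a6, n1, n2, n3⟩ := h
  have l0 : (Fin.last (k + 1) : Fin (k + 2)) ≠ 0 := by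
    intro h; have := congrArg Fin.val h; simp at this
  have l0' : (0 : Fin (k + 2)) ≠ Fin.last (k + 1) := fun h => l0 h.symm
  have n1' : F.lab (M₁ ∪ M₃) ≠ F.lab (M₁ ∪ M₂) := fun h => n1 h.symm
  have n2' : F.lab (M₂ ∪ M₃) ≠ F.lab (M₁ ∪ M₂) := fun h => n2 h.symm
  have n3' : F.lab (M₂ ∪ M₃) ≠ F.lab (M₁ ∪ M₃) := fun h => n3 h.symm
  have a1' : Fin.last (k + 1) ≠ F.lab (M₁ ∪ M₂) := fun h => a1 h.symm
  have a2' : (0 : Fin (k + 2)) ≠ F.lab (M₁ ∪ M₂) := fun h => a2 h.symm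
  have a3' : Fin.last (k + 1) ≠ F.lab (M₁ ∪ M₃) := fun h => a3 h.symm
  have a4' : (0 : Fin (k + 2)) ≠ F.lab (M₁ ∪ M₃) := fun h => a4 h.symm
  have a5' : Fin.last (k + 1) ≠ F.lab (M₂ ∪ M₃) := fun h => a5 h.symm
  have a6' : (0 : Fin (k + 2)) ≠ F.lab (M₂ ∪ M₃) := fun h => a6 h.symm
  rcases b with ⟨_ | _, _ | _, _ | _⟩ <;> rcases b' with ⟨_ | _, _ | _, _ | _⟩ <;>
    simp only [modUnion, if_true, Bool.false_eq_true, if_false, empty_union, union_empty, mlCostar] <;>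
    first
    | decide
    | simp_all

/-- The memberships of block `i` in a pattern triple, as Booleans. [this work] -/
def memb (P : (Finset (Fin 3) × Finset (Fin 3)) × Finset (Fin 3)) (i : Fin 3) : Bool × Bool × Bool :=
  (decide (i ∈ P.1.1), decide (i ∈ P.1.2), decide (i ∈ P.2))

/-- The grouped coefficients of the co-star MODEL (a computable integer for each size profile). [this work] -/
def coef3Costar (j : (ℕ × ℕ) × ℕ) : ℤ :=
  ∑ P ∈ (((univ : Finset (Finset (Fin 3))) ×ˢ (univ : Finset (Finset (Fin 3)))) ×ˢ (univ : Finset (Finset (Fin 3)))).filter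
      (fun P => ((P.1.1.card, P.1.2.card), P.2.card) = j),
    s6K 3 (mlCostar (memb P 0)) (mlCostar (memb P 1)) (mlCostar (memb P 2))

/-- Transport: under the co-star hypotheses the grouped coefficients of `F` are those of the model. [this work] -/
theorem IsCoStarQuotient.coef3_eq (h : F.IsCoStarQuotient M₁ M₂ M₃) (j : (ℕ × ℕ) × ℕ) :
    F.coef3 M₁ M₂ M₃ j = coef3Costar j := by
  unfold coef3 coef3Costar
  refine sum_congr rfl fun P _ => ?_
  rw [glue_union_eq_modUnion, glue_union_eq_modUnion, glue_union_eq_modUnion]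
  exact s6K_congr (h.chart_tb _).1 (h.chart_tb _).2 (h.chart_tb _).1 (h.chart_tb _).2 (h.chart_tb _).1 (h.chart_tb _).2
    (h.chart_eq _ _) (h.chart_eq _ _) (h.chart_eq _ _)

set_option maxRecDepth 200000 in
/-- The 64 grouped coefficients of the co-star model are nonnegative (finite check; in fact `Z = 6(a₁b₁c₁ + a₁b₁c₂ + a₁b₂c₁ + a₂b₁c₁)`). [this work] -/
theorem coef3Costar_nonneg : ∀ j ∈ ((range 4) ×ˢ (range 4)) ×ˢ (range 4), 0 ≤ coef3Costar j := by
  decide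

/-- **★ₖ for every blow-up of the co-star structure by three arbitrary gadgets** (all co-stars `co-star(a,b,c)` with or without dummies, the doubled
star `co-star(2,2,2)`, mixed OR/AND/majority legs, …, for all sizes): if the ground set of `F` is the disjoint union of three modules whose quotient is
the co-star structure (`IsCoStarQuotient`), then `0 ≤ F.ZK`. [this work] -/
theorem ZK_nonneg_of_isCoStarQuotient [Fintype α] {g₁ g₂ g₃ : Finset α → Bool}
    (h₁ : F.IsModule M₁ g₁) (h₂ : F.IsModule M₂ g₂) (h₃ : F.IsModule M₃ g₃)
    (d₁₂ : Disjoint M₁ M₂) (d₁₃ : Disjoint M₁ M₃) (d₂₃ : Disjoint M₂ M₃) (hcov : M₁ ∪ M₂ ∪ M₃ = univ)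
    (hq : F.IsCoStarQuotient M₁ M₂ M₃) : 0 ≤ F.ZK :=
  F.ZK_nonneg_of_coef3_nonneg h₁ h₂ h₃ d₁₂ d₁₃ d₂₃ hcov fun j hj => by
    rw [hq.coef3_eq j]; exact coef3Costar_nonneg j hj

end CoStar

end MSunflower

end Summit.CriticalPhenomena.PercolationContinuityZ3.Theorems.SunflowerPartition
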